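import Mathlib.Analysis.Fourier.ZMod

/-!
# Crux `DlogGraphFlat` (stmt-QuantumAdvantage-10732), line `Sketch_holder_energy` — Hölder pairing

Root-free Hölder pairing across the discrete Fourier transform of `ℤ/N` (`N = p − 1` in the
line): for `a s : ℤ/N → ℂ`,
`N⁴ ‖∑_x a(x) s(x)‖⁴ ≤ (∑_k ‖𝓕a(k)‖)² (∑_k ‖𝓕a(k)‖²) (∑_k ‖𝓕s(k)‖⁴)`
(the registered stub `stub_hePairing`): `|∑_x a(x)s(x)|` is controlled by the `ℓ¹` and `ℓ²` norms
of `𝓕a` and the `ℓ⁴` norm of `𝓕s`.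

Proof: Fourier inversion (`ZMod.dft_dft`) gives the pairing identity
`N ∑_x a(x) s(x) = ∑_k 𝓕a(k) 𝓕s(−k)` (`hePairing_sum_mul_eq`), whence
`N ‖∑ a s‖ ≤ ∑_k ‖𝓕a(k)‖ ‖𝓕s(−k)‖`; then two Cauchy–Schwarz steps
(`Finset.sum_sq_le_sum_mul_sum_of_sq_le_mul`) with `u_k = ‖𝓕a(k)‖`, `v_k = ‖𝓕s(−k)‖`:
`(∑ u v)² ≤ (∑ u)(∑ u v²)` and `(∑ u v²)² ≤ (∑ u²)(∑ v⁴)`, and finally `∑_k v_k⁴ = ∑_k ‖𝓕s(k)‖⁴`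
by `k ↦ −k`. No new definitions.
-/

set_option linter.dupNamespace false -- D-0017: single-problem summit ⇒ `QuantumAdvantage.QuantumAdvantage` by design

namespace Summit.QuantumAdvantage.QuantumAdvantage.Theorems.SymplecticPurity

open scoped ZMod
open Finset

/-! ### The pairing identity and the two Cauchy–Schwarz steps -/

section HePairing

variable {N : ℕ} [NeZero N]

/-- Parseval-type pairing identity from Fourier inversion:
`N ∑_x a(x) s(x) = ∑_k 𝓕a(k) · 𝓕s(−k)`. -/
theorem hePairing_sum_mul_eq (a s : ZMod N → ℂ) :
    (N : ℂ) * ∑ x : ZMod N, a x * s x = ∑ k : ZMod N, 𝓕 a k * 𝓕 s (-k) := by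
  have hinv : ∀ x : ZMod N,
      (N : ℂ) * a x = ∑ k : ZMod N, (ZMod.stdAddChar (k * x) : ℂ) * 𝓕 a k := by
    intro x
    have h := congr_fun (ZMod.dft_dft a) (-x)
    simp only [neg_neg, smul_eq_mul] at h
    rw [← h, ZMod.dft_apply]
    refine Finset.sum_congr rfl fun k _ => ?_
    rw [smul_eq_mul, mul_neg, neg_neg]
  calc (N : ℂ) * ∑ x : ZMod N, a x * s x
      = ∑ x : ZMod N, (N : ℂ) * a x * s x := by
        rw [Finset.mul_sum]
        exact Finset.sum_congr rfl fun x _ => (mul_assoc _ _ _).symm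
    _ = ∑ x : ZMod N, ∑ k : ZMod N, 𝓕 a k * ((ZMod.stdAddChar (k * x) : ℂ) * s x) := by
        refine Finset.sum_congr rfl fun x _ => ?_
        rw [hinv, Finset.sum_mul]
        exact Finset.sum_congr rfl fun k _ => by ring
    _ = ∑ k : ZMod N, 𝓕 a k * 𝓕 s (-k) := by
        rw [Finset.sum_comm]
        refine Finset.sum_congr rfl fun k _ => ?_
        rw [← Finset.mul_sum, ZMod.dft_apply]
        congr 1
        refine Finset.sum_congr rfl fun x _ => ?_
        rw [smul_eq_mul, mul_neg, neg_neg, mul_comm x k]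

/-- Triangle inequality after the pairing identity: `N ‖∑_x a(x) s(x)‖ ≤ ∑_k ‖𝓕a(k)‖ ‖𝓕s(−k)‖`. -/
theorem hePairing_norm_le (a s : ZMod N → ℂ) :
    (N : ℝ) * ‖∑ x : ZMod N, a x * s x‖ ≤ ∑ k : ZMod N, ‖𝓕 a k‖ * ‖𝓕 s (-k)‖ := by
  have h := congr_arg norm (hePairing_sum_mul_eq a s)
  rw [norm_mul, Complex.norm_natCast] at h
  rw [h]
  refine (norm_sum_le _ _).trans (le_of_eq ?_)
  exact Finset.sum_congr rfl fun k _ => norm_mul _ _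

/-- Two Cauchy–Schwarz steps, root-free: `(∑ u v)⁴ ≤ (∑ u)² (∑ u²) (∑ v⁴)` for nonnegative `u`
(write `u v = √u · (√u v)`, then `u v² = u · v²`). -/
theorem hePairing_sum_mul_pow_four_le {ι : Type*} (t : Finset ι) (u v : ι → ℝ)
    (hu : ∀ i ∈ t, 0 ≤ u i) :
    (∑ i ∈ t, u i * v i) ^ 4 ≤
      (∑ i ∈ t, u i) ^ 2 * (∑ i ∈ t, u i ^ 2) * ∑ i ∈ t, v i ^ 4 := by
  have h1 : (∑ i ∈ t, u i * v i) ^ 2 ≤ (∑ i ∈ t, u i) * ∑ i ∈ t, u i * v i ^ 2 :=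
    Finset.sum_sq_le_sum_mul_sum_of_sq_le_mul t hu
      (fun i hi => mul_nonneg (hu i hi) (sq_nonneg _)) (fun i _ => le_of_eq (by ring))
  have h2 : (∑ i ∈ t, u i * v i ^ 2) ^ 2 ≤ (∑ i ∈ t, u i ^ 2) * ∑ i ∈ t, v i ^ 4 :=
    Finset.sum_sq_le_sum_mul_sum_of_sq_le_mul t (fun i _ => sq_nonneg _)
      (fun i _ => by positivity) (fun i _ => le_of_eq (by ring))
  have hA : 0 ≤ ∑ i ∈ t, u i := Finset.sum_nonneg hu
  calc (∑ i ∈ t, u i * v i) ^ 4 = ((∑ i ∈ t, u i * v i) ^ 2) ^ 2 := by ring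
    _ ≤ ((∑ i ∈ t, u i) * ∑ i ∈ t, u i * v i ^ 2) ^ 2 := by gcongr
    _ = (∑ i ∈ t, u i) ^ 2 * (∑ i ∈ t, u i * v i ^ 2) ^ 2 := by ring
    _ ≤ (∑ i ∈ t, u i) ^ 2 * ((∑ i ∈ t, u i ^ 2) * ∑ i ∈ t, v i ^ 4) := by gcongr
    _ = (∑ i ∈ t, u i) ^ 2 * (∑ i ∈ t, u i ^ 2) * ∑ i ∈ t, v i ^ 4 := by ring

end HePairing

/-! ### The registered stub -/

/-- **Hölder pairing across the DFT of `ℤ/N` (root-free form).** For `a s : ℤ/N → ℂ`,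
`N⁴ ‖∑_x a(x) s(x)‖⁴ ≤ (∑_k ‖𝓕a(k)‖)² · (∑_k ‖𝓕a(k)‖²) · (∑_k ‖𝓕s(k)‖⁴)`. -/
theorem stub_hePairing : ∀ (N : ℕ) [NeZero N] (a s : ZMod N → ℂ),
    (N : ℝ) ^ 4 * ‖∑ x : ZMod N, a x * s x‖ ^ 4 ≤
      (∑ k : ZMod N, ‖ZMod.dft a k‖) ^ 2 * (∑ k : ZMod N, ‖ZMod.dft a k‖ ^ 2) *
        (∑ k : ZMod N, ‖ZMod.dft s k‖ ^ 4) := by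
  intro N _ a s
  have h1 := hePairing_norm_le a s
  have h2 := hePairing_sum_mul_pow_four_le Finset.univ (fun k => ‖𝓕 a k‖) (fun k => ‖𝓕 s (-k)‖)
    (fun k _ => norm_nonneg _)
  have hneg : ∑ k : ZMod N, ‖𝓕 s (-k)‖ ^ 4 = ∑ k : ZMod N, ‖𝓕 s k‖ ^ 4 :=
    Fintype.sum_equiv (Equiv.neg _) _ _ fun k => by simp
  have h0 : 0 ≤ (N : ℝ) * ‖∑ x : ZMod N, a x * s x‖ := by positivity
  calc (N : ℝ) ^ 4 * ‖∑ x : ZMod N, a x * s x‖ ^ 4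
      = ((N : ℝ) * ‖∑ x : ZMod N, a x * s x‖) ^ 4 := by ring
    _ ≤ (∑ k : ZMod N, ‖𝓕 a k‖ * ‖𝓕 s (-k)‖) ^ 4 := by gcongr
    _ ≤ (∑ k : ZMod N, ‖𝓕 a k‖) ^ 2 * (∑ k : ZMod N, ‖𝓕 a k‖ ^ 2) *
          ∑ k : ZMod N, ‖𝓕 s (-k)‖ ^ 4 := h2
    _ = _ := by rw [hneg]

end Summit.QuantumAdvantage.QuantumAdvantage.Theorems.SymplecticPurity
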